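import Summits.ResolutionOfSingularities.ResolutionOfSingularities.Theorems.ShadowsUniformize.Negative.IdentityShadow

/-!
# `ShadowsUniformize` — negative lemmas II: the load-bearing clauses [fg] and [exact]

Support (negative) lemmas for the crux `stmt-ResolutionOfSingularities-16756`
(`Summit.ResolutionOfSingularities.ResolutionOfSingularities.Theses.AbhyankarShadows.ShadowsUniformize`,
route AbhyankarShadows, crux #2 = the TRANSFER half of Teissier's semivaluation conjecture,
arXiv:2311.12456 p. 5, as typed by the planner). Companion of `Negative/IdentityShadow.lean`
(§0–§2 there); filed by the standing disprover (cdisprove cycles 1–2; work file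
`Cruxes/ShadowsUniformize/Disproof.lean`, §3). The file declares NO definition: every mutated
clause is written out inline.

The shadow hypothesis of the crux asks, for every finite `F ⊆ R`, for a local blowing up
`R ≤ R₁ ⊆ O`, a `k`-algebra map `φ : R₁ → L` and a valuation ring `O'` of `L` with eight clauses
[rank] [inside] [centre] [rational'] [fg] [inj] [values] [exact]. Which of them carry weight?

## Findings (all sorry-free)

* `shadowClause_without_fg` — delete [fg] ("the value semigroup of `ν'` on `φ(R₁)` is finitely
  generated"): the IDENTITY shadow (`L = K`, `φ = R₁ ↪ K`, `O' = O`, `ι = id`) then serves EVERY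
  rational `(O, R)` and every `F`, so the mutated crux is LITERALLY EQUIVALENT to the route target
  `LurelRational` (relative local uniformization at all rational places over algebraically closed
  fields of characteristic `p`); the one-line equivalence `shadowsUniformize_without_fg_iff` is
  spelled out in the crux work file `Cruxes/ShadowsUniformize/Disproof.lean` §3 (its statement,
  the mutated crux written in full, is too large for this lane).
* `residueConstantShadow` — at a rational place the map `y ↦ c(y)`, `c(y) ∈ k` the residue
  constant (`ν(y - c(y)) > 0`), is a `k`-ALGEBRA HOMOMORPHISM `R₁ → k ⊆ K` with the SAME CENTRE as
  `ν`, value semigroup `{0, 1}` (finitely generated) and all its non-zero values among the values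
  of `ν` on `R₁`; it satisfies every shadow clause except exactness on `F`.
* `shadowClause_without_exact` — delete [exact] ("`ι (ν'(φ x)) = ν(x)` for `x ∈ F`"): the
  residue-constant shadow serves every `(O, R, F)`, so the mutated crux is again LITERALLY
  EQUIVALENT to `LurelRational` (`shadowsUniformize_without_exact_iff` in the work file, §3).

Consequence for provers: [fg] ∧ [exact] jointly are the only channel through which a shadow sees
`ν` beyond its centre; [rank] [inside] [centre] [rational'] [inj] [values] are normalisations. Any
proof of the crux must use [fg] and [exact] together — and on the locus where they are jointly
cheap (identity shadow at discrete places, `Negative/IdentityShadow.lean`; scaled arcs at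
rational-rank-one places after embedded local uniformization, refuter ATTACK.md on the item) the
crux is plain local uniformization.

## Sources
* B. Teissier, arXiv:2311.12456 (LNM 2313, 2023), p. 5 (the conjecture and its clauses).
-/

noncomputable section

open Summit.ResolutionOfSingularities.ResolutionOfSingularities.Theses.AbhyankarShadows

set_option linter.dupNamespace false -- mandated namespace of this single-conjunct summit

namespace Summit.ResolutionOfSingularities.ResolutionOfSingularities.Theorems.ShadowsUniformize.Negative

/-! ## §3 Load-bearing clauses: deleting [fg] or [exact] collapses the crux onto the target -/

section LoadBearing

variable {k K : Type} [Field k] [Field K] [Algebra k K]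

/-- **With [fg] deleted the shadow clause is free**: for EVERY valuation ring `O ∋ k` of a finitely
generated `K/k` which is rational, and every finitely generated `R ⊆ O`, the shadow clause minus
"the value semigroup of `ν'` on `φ(R₁)` is finitely generated" holds for every finite `F` (identity
shadow on a birational enlargement). [folklore] -/
theorem shadowClause_without_fg (hKfg : (⊤ : IntermediateField k K).FG)
    (O : ValuationSubring K) (hk : ∀ c : k, algebraMap k K c ∈ O)
    (hrat : ∀ x : K, x ∈ O → ∃ c : k, O.valuation (x - algebraMap k K c) < 1)
    (R : Subalgebra k K) (hR : R.FG) (hRO : R.toSubring ≤ O.toSubring) :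
    ∀ F : Finset R, ∃ (R₁ : Subalgebra k K) (hle : R ≤ R₁) (_ : R₁.toSubring ≤ O.toSubring),
    R₁.FG ∧ IsFractionRing R₁ K ∧ ∃ (L : Type) (_ : Field L) (_ : Algebra k L) (φ : R₁ →ₐ[k] L)
    (O' : ValuationSubring L), Module.finrank ℤ (Additive (O'.ValueGroup)ˣ) =
      Module.finrank ℤ (Additive (O.ValueGroup)ˣ) ∧ (∀ y : R₁, φ y ∈ O') ∧
    (∀ y : R₁, O'.valuation (φ y) < 1 ↔ O.valuation (y : K) < 1) ∧
    (∀ z : L, z ∈ O' → ∃ c : k, O'.valuation (z - algebraMap k L c) < 1) ∧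
    ∃ ι : O'.ValueGroup →*₀o O.ValueGroup, Function.Injective ι ∧
      (∀ y : R₁, φ y ≠ 0 → ∃ y' : R₁, ι (O'.valuation (φ y)) = O.valuation (y' : K)) ∧
      ∀ x ∈ F, ι (O'.valuation (φ (Subalgebra.inclusion hle x))) = O.valuation ((x : R) : K) := by
  intro F
  obtain ⟨R₁, hle, hR₁O, hR₁, hfrac⟩ := exists_fg_isFractionRing_le hKfg O hk R hR hRO
  exact ⟨R₁, hle, hR₁O, hR₁, hfrac, K, inferInstance, inferInstance, R₁.val, O, rfl,
    fun y => hR₁O y.2, fun _ => Iff.rfl, hrat, OrderMonoidWithZeroHom.id _,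
    fun _ _ h => h, fun y _ => ⟨y, rfl⟩, fun _ _ => rfl⟩

/-- **The residue-constant shadow.** For a rational valuation ring `O ∋ k` and any `R₁ ⊆ O`, the
map `φ : R₁ → K` sending `y` to the unique constant `c ∈ k` with `ν(y - c) > 0` is a `k`-algebra
homomorphism into `O` with the SAME CENTRE as `ν`, value semigroup `{0, 1}` (finitely generated),
and every non-zero value of `φ` is a value of `ν` on `R₁` (namely `1 = ν(1)`). It satisfies every
shadow clause except exactness on `F`. [folklore] -/
theorem residueConstantShadow (O : ValuationSubring K) (hk : ∀ c : k, algebraMap k K c ∈ O)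
    (hrat : ∀ x : K, x ∈ O → ∃ c : k, O.valuation (x - algebraMap k K c) < 1)
    (R₁ : Subalgebra k K) (hR₁O : R₁.toSubring ≤ O.toSubring) :
    ∃ φ : R₁ →ₐ[k] K, (∀ y : R₁, ∃ c : k, φ y = algebraMap k K c) ∧
      (∀ y : R₁, O.valuation ((y : K) - φ y) < 1) ∧
      (∀ y : R₁, φ y ∈ O) ∧
      (∀ y : R₁, O.valuation (φ y) < 1 ↔ O.valuation (y : K) < 1) ∧
      (MonoidHom.mrange (O.valuation.toMonoidWithZeroHom.toMonoidHom.comp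
        φ.toRingHom.toMonoidHom)).FG ∧
      (∀ y : R₁, φ y ≠ 0 → ∃ y' : R₁, O.valuation (φ y) = O.valuation (y' : K)) := by
  classical
  -- the residue constant and its uniqueness
  let res : R₁ → k := fun y => Classical.choose (hrat (y : K) (hR₁O y.2))
  have res_spec : ∀ y : R₁, O.valuation ((y : K) - algebraMap k K (res y)) < 1 := fun y =>
    Classical.choose_spec (hrat (y : K) (hR₁O y.2))
  have res_eq : ∀ (y : R₁) (c : k), O.valuation ((y : K) - algebraMap k K c) < 1 → res y = c :=
    fun y c h => residueConstant_unique O hk (res_spec y) h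
  have hv1 : ∀ y : R₁, O.valuation (y : K) ≤ 1 := fun y =>
    (O.valuation_le_one_iff _).mpr (hR₁O y.2)
  have res_mul : ∀ y y' : R₁, res (y * y') = res y * res y' := by
    intro y y'
    apply res_eq
    have : ((y * y' : R₁) : K) - algebraMap k K (res y * res y') =
        (y : K) * ((y' : K) - algebraMap k K (res y')) +
          algebraMap k K (res y') * ((y : K) - algebraMap k K (res y)) := by
      rw [map_mul]; push_cast; ring
    rw [this]
    refine Valuation.map_add_lt _ ?_ ?_
    · rw [map_mul]
      calc O.valuation (y : K) * O.valuation ((y' : K) - algebraMap k K (res y'))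
          ≤ 1 * O.valuation ((y' : K) - algebraMap k K (res y')) := mul_le_mul' (hv1 y) le_rfl
        _ < 1 := by rw [one_mul]; exact res_spec y'
    · rw [map_mul]
      calc O.valuation (algebraMap k K (res y')) * O.valuation ((y : K) - algebraMap k K (res y))
          ≤ 1 * O.valuation ((y : K) - algebraMap k K (res y)) :=
            mul_le_mul' ((O.valuation_le_one_iff _).mpr (hk _)) le_rfl
        _ < 1 := by rw [one_mul]; exact res_spec y
  have res_add : ∀ y y' : R₁, res (y + y') = res y + res y' := by
    intro y y'
    apply res_eq
    have : ((y + y' : R₁) : K) - algebraMap k K (res y + res y') =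
        ((y : K) - algebraMap k K (res y)) + ((y' : K) - algebraMap k K (res y')) := by
      rw [map_add]; push_cast; ring
    rw [this]
    exact Valuation.map_add_lt _ (res_spec y) (res_spec y')
  have res_one : res 1 = 1 := res_eq 1 1 (by simp)
  have res_zero : res 0 = 0 := res_eq 0 0 (by simp)
  have res_algebraMap : ∀ c : k, res (algebraMap k R₁ c) = c := fun c =>
    res_eq _ c (by simp)
  -- the `k`-algebra map `y ↦ res y ∈ k ⊆ K`
  let φ : R₁ →ₐ[k] K :=
    { toFun := fun y => algebraMap k K (res y)
      map_one' := by simp only [res_one, map_one]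
      map_mul' := fun y y' => by simp only [res_mul, map_mul]
      map_zero' := by simp only [res_zero, map_zero]
      map_add' := fun y y' => by simp only [res_add, map_add]
      commutes' := fun c => by simp only [res_algebraMap] }
  have hφ : ∀ y : R₁, φ y = algebraMap k K (res y) := fun y => rfl
  have hlt_iff : ∀ y : R₁, O.valuation (φ y) < 1 ↔ res y = 0 := by
    intro y
    rw [hφ]
    constructor
    · intro h
      by_contra hne
      rw [Summit.ResolutionOfSingularities.ResolutionOfSingularities.Theorems.PfaffLine.ap_valuation_algebraMap_eq_one O hk hne] at h
      exact lt_irrefl _ h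
    · intro h
      rw [h, map_zero, map_zero]
      exact zero_lt_one
  have hcentre : ∀ y : R₁, O.valuation (φ y) < 1 ↔ O.valuation (y : K) < 1 := by
    intro y
    rw [hlt_iff]
    constructor
    · intro h
      have := res_spec y
      rwa [h, map_zero, sub_zero] at this
    · intro h
      exact res_eq y 0 (by rwa [map_zero, sub_zero])
  refine ⟨φ, fun y => ⟨res y, rfl⟩, fun y => res_spec y, fun y => hk _, hcentre, ?_, ?_⟩
  · -- the semigroup is `{0, 1}`
    refine ⟨{0}, le_antisymm ?_ ?_⟩
    · refine Submonoid.closure_le.mpr ?_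
      intro x hx
      rw [Finset.coe_singleton, Set.mem_singleton_iff] at hx
      exact ⟨0, by simp [hx]⟩
    · rintro x ⟨y, rfl⟩
      by_cases hy : res y = 0
      · have : (O.valuation.toMonoidWithZeroHom.toMonoidHom.comp φ.toRingHom.toMonoidHom) y =
            0 := by
          change O.valuation (φ y) = 0
          rw [hφ, hy, map_zero, map_zero]
        rw [this]
        exact Submonoid.subset_closure (by simp)
      · have : (O.valuation.toMonoidWithZeroHom.toMonoidHom.comp φ.toRingHom.toMonoidHom) y =
            1 := by
          change O.valuation (φ y) = 1
          rw [hφ]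
          exact Summit.ResolutionOfSingularities.ResolutionOfSingularities.Theorems.PfaffLine.ap_valuation_algebraMap_eq_one O hk hy
        rw [this]
        exact one_mem _
  · intro y hy
    refine ⟨1, ?_⟩
    have hne : res y ≠ 0 := by
      intro h
      apply hy
      rw [hφ, h, map_zero]
    rw [hφ, Summit.ResolutionOfSingularities.ResolutionOfSingularities.Theorems.PfaffLine.ap_valuation_algebraMap_eq_one O hk hne]
    simp

/-- **With [exact] deleted the shadow clause is free**: for EVERY rational valuation ring `O ∋ k`
of a finitely generated `K/k` and every finitely generated `R ⊆ O`, the shadow clause minus its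
last conjunct "`ι ∘ ν' ∘ φ = ν` on `F`" holds (residue-constant shadow on a birational
enlargement, `O' = O`, `ι = id`). [folklore] -/
theorem shadowClause_without_exact (hKfg : (⊤ : IntermediateField k K).FG)
    (O : ValuationSubring K) (hk : ∀ c : k, algebraMap k K c ∈ O)
    (hrat : ∀ x : K, x ∈ O → ∃ c : k, O.valuation (x - algebraMap k K c) < 1)
    (R : Subalgebra k K) (hR : R.FG) (hRO : R.toSubring ≤ O.toSubring) :
    ∃ (R₁ : Subalgebra k K) (_ : R ≤ R₁) (_ : R₁.toSubring ≤ O.toSubring),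
    R₁.FG ∧ IsFractionRing R₁ K ∧ ∃ (L : Type) (_ : Field L) (_ : Algebra k L) (φ : R₁ →ₐ[k] L)
    (O' : ValuationSubring L), Module.finrank ℤ (Additive (O'.ValueGroup)ˣ) =
      Module.finrank ℤ (Additive (O.ValueGroup)ˣ) ∧ (∀ y : R₁, φ y ∈ O') ∧
    (∀ y : R₁, O'.valuation (φ y) < 1 ↔ O.valuation (y : K) < 1) ∧
    (∀ z : L, z ∈ O' → ∃ c : k, O'.valuation (z - algebraMap k L c) < 1) ∧
    (MonoidHom.mrange (O'.valuation.toMonoidWithZeroHom.toMonoidHom.comp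
      φ.toRingHom.toMonoidHom)).FG ∧
    ∃ ι : O'.ValueGroup →*₀o O.ValueGroup, Function.Injective ι ∧
      (∀ y : R₁, φ y ≠ 0 → ∃ y' : R₁, ι (O'.valuation (φ y)) = O.valuation (y' : K)) := by
  obtain ⟨R₁, hle, hR₁O, hR₁, hfrac⟩ := exists_fg_isFractionRing_le hKfg O hk R hR hRO
  obtain ⟨φ, -, -, hin, hcentre, hfg, hval⟩ := residueConstantShadow O hk hrat R₁ hR₁O
  exact ⟨R₁, hle, hR₁O, hR₁, hfrac, K, inferInstance, inferInstance, φ, O, rfl, hin, hcentre, hrat,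
    hfg, OrderMonoidWithZeroHom.id _, fun _ _ h => h, hval⟩

end LoadBearing

end Summit.ResolutionOfSingularities.ResolutionOfSingularities.Theorems.ShadowsUniformize.Negative

end
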